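import Literature.NumberTheory.LFunctions.Zhang2022.Section3Lemma31
import Mathlib.Analysis.Complex.AbsMax
import HarnessLib

/-!
# Zhang (2022), Lemma 5.8: `L(s,χ) = L′(1,χ)(s−1) + O(α₂)` near `s = 1` under (A), kernel-checked

Topic `Literature/NumberTheory/LFunctions/Zhang2022` (Landau–Siegel autopsy tree; verdict-neutral).
Y. Zhang, *Discrete mean estimates and the Landau–Siegel zero*, arXiv:2211.02515v1 (2022) — **an
unrefereed manuscript, a claimed result under adjudication** — §5, Lemma 5.8 (p. 11):

> **Lemma 5.8.** If `α ≤ |s − 1| ≤ 10α`, then `L(s,χ) = L′(1,χ)(s−1) + O(α₂)` where `α₂ = 𝓛^{-15}`.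
> *Proof.* This follows from the relation `L(s,χ) = L(1,χ) + L′(1,χ)(s−1) + ∫₁ˢ (s−w)L″(w,χ) dw`,
> (A) and a simple bound for `L″(w,χ)`. □

Here `χ` is the real primitive character mod `D`, `𝓛 = log D` (2.1), `P = exp{𝓛⁹}` (2.6),
`α = π/log P = π𝓛^{-9}` (2.10), and (A) is `L(1,χ) < 𝓛^{-2022}`.

This file PROVES the lemma (`lemma_5_8`, with the printed range `|s−1| ≤ 10α`; `lemma_5_8_of_le`
for `|s−1| ≤ Kα`, the wider range `≤ 13α` in which Part II of the source actually invokes it — cell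
record E-II-g20-2) from a Taylor estimate with Cauchy/maximum-modulus bounds in place of the
integral remainder: writing `g = dslope L(·,χ) 1` and `k = dslope g 1` (Mathlib's `dslope`),
`L(s,χ) − L(1,χ) − L′(1,χ)(s−1) = (s−1)² k(s)` EXACTLY (`LFunction_taylor_two`), and on the disc
`|s−1| ≤ 1/𝓛` the maximum modulus principle (Mathlib `Complex.norm_le_of_forall_mem_frontier_norm_le`)
and the tree's near-one bound `‖L(w,χ)‖ ≤ 2e^{9/2}(1+𝓛)` for `|w−1| ≤ 2/𝓛`
(`Lemma31.norm_LFunction_le_near_one`, Pólya–Vinogradov strength) give `‖k(s)‖ ≤ 8e^{9/2}(1+𝓛)𝓛²`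
(`norm_taylor_two_remainder_le`: `‖L(s,χ) − L(1,χ) − L′(1,χ)(s−1)‖ ≤ 8e^{9/2}(1+𝓛)𝓛²|s−1|²`, the
"simple bound for `L″`" made explicit). With `|s−1| ≤ Kπ𝓛^{-9}` this is `≤ 16e^{9/2}π²K²𝓛^{-15}`,
and `‖L(1,χ)‖ ≤ 𝓛^{-2022} ≤ 𝓛^{-15}` by (A): `‖L(s,χ) − L′(1,χ)(s−1)‖ ≤ (1 + 16e^{9/2}π²K²) α₂`.

Only definitions of the manuscript are used; nothing about its Theorems 1–2 is stated or implied;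
the cell's verdict (the located failure of (8.24)) is independent of this lemma (STEPS row L5.8,
"shown" by hand; this file makes it kernel-checked). The lower bound `|s−1| ≥ α` of the printed
hypothesis is not needed for the upper bound proved here (it matters only where the source divides
by `L′(1,χ)(s−1)`, cf. Lemma 5.7).

## References

* Y. Zhang, arXiv:2211.02515v1 (2022), §5 Lemma 5.8; §2 (2.1), (2.6), (2.10).
  [cite: Zhang2022LandauSiegel, §5, Lemma 5.8]
-/

noncomputable section

open Complex Filter Topology Set Real Metric

namespace Literature.NumberTheory.LFunctions.Zhang2022.Lemma58

open Literature.NumberTheory.LFunctions.Zhang2022.Lemma31 (norm_LFunction_le_near_one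
  ne_one_of_isPrimitive)

variable {q : ℕ} [NeZero q] (χ : DirichletCharacter ℂ q)

/-! ### §1. The exact second-order Taylor identity via `dslope` -/

/-- `g = dslope L(·,χ) 1`: `L(s,χ) = L(1,χ) + (s−1) g(s)`, `g(1) = L′(1,χ)`. [folklore] -/
def dslopeL : ℂ → ℂ := dslope χ.LFunction 1

/-- `k = dslope g 1`: `g(s) = g(1) + (s−1) k(s)`. [folklore] -/
def dslope2L : ℂ → ℂ := dslope (dslopeL χ) 1

/-- `L(s,χ) = L(1,χ) + (s−1) g(s)`. [folklore] -/
theorem LFunction_eq_add_mul_dslopeL (s : ℂ) : χ.LFunction s = χ.LFunction 1 + (s - 1) * dslopeL χ s := by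
  have h := sub_smul_dslope χ.LFunction 1 s
  rw [smul_eq_mul] at h
  rw [dslopeL]
  linear_combination -h

/-- `g(1) = L′(1,χ)`. [folklore] -/
theorem dslopeL_one : dslopeL χ 1 = deriv χ.LFunction 1 := by rw [dslopeL, dslope_same]

/-- `g(s) = L′(1,χ) + (s−1) k(s)`. [folklore] -/
theorem dslopeL_eq_add_mul_dslope2L (s : ℂ) : dslopeL χ s = deriv χ.LFunction 1 + (s - 1) * dslope2L χ s := by
  have h := sub_smul_dslope (dslopeL χ) 1 s
  rw [smul_eq_mul, dslopeL_one] at h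
  rw [dslope2L]
  linear_combination -h

/-- **The exact Taylor identity of order two**:
`L(s,χ) − L(1,χ) − L′(1,χ)(s−1) = (s−1)² k(s)`. [cite: Zhang2022LandauSiegel, §5, proof of Lemma 5.8
("L(s,χ) = L(1,χ) + L′(1,χ)(s−1) + ∫₁ˢ(s−w)L″(w,χ)dw")] -/
theorem LFunction_taylor_two (s : ℂ) :
    χ.LFunction s - χ.LFunction 1 - deriv χ.LFunction 1 * (s - 1) = (s - 1) ^ 2 * dslope2L χ s := by
  rw [LFunction_eq_add_mul_dslopeL χ s, dslopeL_eq_add_mul_dslope2L χ s]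
  ring

/-- `g` is entire (`χ ≠ 1`). [folklore] -/
theorem differentiable_dslopeL (hχ1 : χ ≠ 1) : Differentiable ℂ (dslopeL χ) := by
  have hL := DirichletCharacter.differentiable_LFunction hχ1
  intro z
  rcases eq_or_ne z 1 with rfl | hz
  · obtain ⟨p, hp⟩ := hL.analyticAt 1
    exact (hp.has_fpower_series_dslope_fslope.analyticAt).differentiableAt
  · exact (differentiableAt_dslope_of_ne hz).2 (hL z)

/-- `k` is entire (`χ ≠ 1`). [folklore] -/
theorem differentiable_dslope2L (hχ1 : χ ≠ 1) : Differentiable ℂ (dslope2L χ) := by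
  have hg := differentiable_dslopeL χ hχ1
  intro z
  rcases eq_or_ne z 1 with rfl | hz
  · obtain ⟨p, hp⟩ := hg.analyticAt 1
    exact (hp.has_fpower_series_dslope_fslope.analyticAt).differentiableAt
  · exact (differentiableAt_dslope_of_ne hz).2 (hg z)

/-! ### §2. Maximum modulus on the disc `|s−1| ≤ 1/log q` -/

/-- **`g` on the closed disc `|s−1| ≤ R = 1/log q`** (`χ` primitive, `log q ≥ 3`):
`‖g(s)‖ ≤ 2·(2e^{9/2}(1+log q))·log q` (maximum modulus: on `|s−1| = R`,
`‖g(s)‖ = ‖L(s,χ) − L(1,χ)‖/R`). [folklore] -/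
theorem norm_dslopeL_le (hq : 3 ≤ Real.log q) (hχ : χ.IsPrimitive) {s : ℂ}
    (hs : ‖s - 1‖ ≤ 1 / Real.log q) :
    ‖dslopeL χ s‖ ≤ 2 * (2 * Real.exp (9 / 2) * (1 + Real.log q)) * Real.log q := by
  have hq2 : 2 ≤ q := by
    rcases Nat.lt_or_ge q 2 with h | h
    · interval_cases q <;> norm_num at hq
    · exact h
  set Lq : ℝ := Real.log q with hL
  set B : ℝ := 2 * Real.exp (9 / 2) * (1 + Lq) with hB
  have hL0 : 0 < Lq := by linarith
  have hR : 0 < 1 / Lq := one_div_pos.2 hL0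
  have hχ1 := ne_one_of_isPrimitive χ hq2 hχ
  have hB0 : 0 ≤ B := by rw [hB]; positivity
  have hd : DiffContOnCl ℂ (dslopeL χ) (ball (1 : ℂ) (1 / Lq)) :=
    (differentiable_dslopeL χ hχ1).diffContOnCl
  have hfront : ∀ z ∈ frontier (ball (1 : ℂ) (1 / Lq)), ‖dslopeL χ z‖ ≤ 2 * B * Lq := by
    intro z hz
    rw [frontier_ball _ hR.ne', mem_sphere, dist_eq_norm] at hz
    have hz1 : z ≠ 1 := by
      intro h; rw [h, sub_self, norm_zero] at hz; exact hR.ne' hz.symm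
    rw [dslopeL, dslope_of_ne _ hz1, slope_def_field, norm_div, hz, div_eq_mul_inv, one_div, inv_inv]
    have h1 : ‖χ.LFunction z‖ ≤ B := norm_LFunction_le_near_one χ hq hχ (by rw [hz, ← hL]; gcongr; norm_num)
    have h2 : ‖χ.LFunction 1‖ ≤ B :=
      norm_LFunction_le_near_one χ hq hχ (by rw [sub_self, norm_zero]; positivity)
    calc ‖χ.LFunction z - χ.LFunction 1‖ * Lq ≤ (‖χ.LFunction z‖ + ‖χ.LFunction 1‖) * Lq :=
          mul_le_mul_of_nonneg_right (norm_sub_le _ _) hL0.le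
      _ ≤ (B + B) * Lq := by gcongr
      _ = 2 * B * Lq := by ring
  have hmem : s ∈ closure (ball (1 : ℂ) (1 / Lq)) := by
    rw [closure_ball _ hR.ne', mem_closedBall, dist_eq_norm]; exact hs
  exact Complex.norm_le_of_forall_mem_frontier_norm_le isBounded_ball hd hfront hmem

/-- **`k` on the closed disc `|s−1| ≤ 1/log q`**: `‖k(s)‖ ≤ 4·(2e^{9/2}(1+log q))·(log q)²`
(maximum modulus again: on `|s−1| = R`, `‖k(s)‖ = ‖g(s) − g(1)‖/R`). [folklore] -/
theorem norm_dslope2L_le (hq : 3 ≤ Real.log q) (hχ : χ.IsPrimitive) {s : ℂ}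
    (hs : ‖s - 1‖ ≤ 1 / Real.log q) :
    ‖dslope2L χ s‖ ≤ 4 * (2 * Real.exp (9 / 2) * (1 + Real.log q)) * Real.log q ^ 2 := by
  have hq2 : 2 ≤ q := by
    rcases Nat.lt_or_ge q 2 with h | h
    · interval_cases q <;> norm_num at hq
    · exact h
  set Lq : ℝ := Real.log q with hL
  set B : ℝ := 2 * Real.exp (9 / 2) * (1 + Lq) with hB
  have hL0 : 0 < Lq := by linarith
  have hR : 0 < 1 / Lq := one_div_pos.2 hL0
  have hχ1 := ne_one_of_isPrimitive χ hq2 hχ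
  have hB0 : 0 ≤ B := by rw [hB]; positivity
  have hd : DiffContOnCl ℂ (dslope2L χ) (ball (1 : ℂ) (1 / Lq)) :=
    (differentiable_dslope2L χ hχ1).diffContOnCl
  have hfront : ∀ z ∈ frontier (ball (1 : ℂ) (1 / Lq)), ‖dslope2L χ z‖ ≤ 4 * B * Lq ^ 2 := by
    intro z hz
    rw [frontier_ball _ hR.ne', mem_sphere, dist_eq_norm] at hz
    have hz1 : z ≠ 1 := by
      intro h; rw [h, sub_self, norm_zero] at hz; exact hR.ne' hz.symm
    rw [dslope2L, dslope_of_ne _ hz1, slope_def_field, norm_div, hz, div_eq_mul_inv, one_div, inv_inv]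
    have h1 : ‖dslopeL χ z‖ ≤ 2 * B * Lq := norm_dslopeL_le χ hq hχ (by rw [hz])
    have h2 : ‖dslopeL χ 1‖ ≤ 2 * B * Lq :=
      norm_dslopeL_le χ hq hχ (by rw [sub_self, norm_zero]; positivity)
    calc ‖dslopeL χ z - dslopeL χ 1‖ * Lq ≤ (‖dslopeL χ z‖ + ‖dslopeL χ 1‖) * Lq :=
          mul_le_mul_of_nonneg_right (norm_sub_le _ _) hL0.le
      _ ≤ (2 * B * Lq + 2 * B * Lq) * Lq := by gcongr
      _ = 4 * B * Lq ^ 2 := by ring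
  have hmem : s ∈ closure (ball (1 : ℂ) (1 / Lq)) := by
    rw [closure_ball _ hR.ne', mem_closedBall, dist_eq_norm]; exact hs
  exact Complex.norm_le_of_forall_mem_frontier_norm_le isBounded_ball hd hfront hmem

/-- **The Taylor remainder** ("a simple bound for `L″(w,χ)`", made explicit): for `χ` primitive
mod `q`, `log q ≥ 3`, `‖s − 1‖ ≤ 1/log q`,
`‖L(s,χ) − L(1,χ) − L′(1,χ)(s−1)‖ ≤ 8e^{9/2}(1+log q)(log q)² ‖s−1‖²`.
[cite: Zhang2022LandauSiegel, §5, proof of Lemma 5.8] -/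
theorem norm_taylor_two_remainder_le (hq : 3 ≤ Real.log q) (hχ : χ.IsPrimitive) {s : ℂ}
    (hs : ‖s - 1‖ ≤ 1 / Real.log q) :
    ‖χ.LFunction s - χ.LFunction 1 - deriv χ.LFunction 1 * (s - 1)‖ ≤
      8 * Real.exp (9 / 2) * (1 + Real.log q) * Real.log q ^ 2 * ‖s - 1‖ ^ 2 := by
  rw [LFunction_taylor_two χ s, norm_mul, norm_pow]
  have hk := norm_dslope2L_le χ hq hχ hs
  have h0 : 0 ≤ ‖s - 1‖ ^ 2 := sq_nonneg _
  calc ‖s - 1‖ ^ 2 * ‖dslope2L χ s‖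
      ≤ ‖s - 1‖ ^ 2 * (4 * (2 * Real.exp (9 / 2) * (1 + Real.log q)) * Real.log q ^ 2) :=
        mul_le_mul_of_nonneg_left hk h0
    _ = _ := by ring

/-! ### §3. Lemma 5.8 -/

/-- **Lemma 5.8 on the range `|s−1| ≤ Kα`**, `α = π𝓛^{-9}` ((2.6), (2.10)), `𝓛 = log D`: for
`χ` primitive mod `D` with `log D ≥ 3`, (A) `‖L(1,χ)‖ ≤ 𝓛^{-2022}`, `K` with `Kπ ≤ 𝓛⁸` (so
that the disc `|s−1| ≤ Kα` lies inside `|s−1| ≤ 1/𝓛`), and every `s` with `‖s − 1‖ ≤ Kπ𝓛^{-9}`: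
`‖L(s,χ) − L′(1,χ)(s−1)‖ ≤ (1 + 16e^{9/2}π²K²)·𝓛^{-15}` (the cell's range note E-II-g20-2: Part II
of the source uses the lemma up to `|s−1| = 13α`). [cite: Zhang2022LandauSiegel, §5, Lemma 5.8] -/
theorem lemma_5_8_of_le {D : ℕ} [NeZero D] (χ : DirichletCharacter ℂ D) (hprim : χ.IsPrimitive)
    (hL : 3 ≤ Real.log D) (hA : ‖χ.LFunction 1‖ ≤ 1 / Real.log D ^ 2022) {K : ℝ}
    (hKL : K * π ≤ Real.log D ^ 8) {s : ℂ} (hs : ‖s - 1‖ ≤ K * π / Real.log D ^ 9) :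
    ‖χ.LFunction s - deriv χ.LFunction 1 * (s - 1)‖ ≤
      (1 + 16 * Real.exp (9 / 2) * π ^ 2 * K ^ 2) / Real.log D ^ 15 := by
  set Lg : ℝ := Real.log D with hLdef
  have hL1 : 1 ≤ Lg := by linarith
  have hL0 : 0 < Lg := by linarith
  have hπ := Real.pi_pos
  -- the disc `|s−1| ≤ Kα` is inside `|s−1| ≤ 1/𝓛`
  have hs1 : ‖s - 1‖ ≤ 1 / Real.log D := by
    rw [← hLdef]
    refine hs.trans ?_
    rw [div_le_div_iff₀ (by positivity) hL0]
    calc K * π * Lg ≤ Lg ^ 8 * Lg := mul_le_mul_of_nonneg_right hKL hL0.le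
      _ = 1 * Lg ^ 9 := by ring
  have hrem := norm_taylor_two_remainder_le χ hL hprim hs1
  rw [← hLdef] at hrem
  -- `‖L(s) − L′(1)(s−1)‖ ≤ ‖L(1)‖ + remainder`
  have hsplit : ‖χ.LFunction s - deriv χ.LFunction 1 * (s - 1)‖ ≤
      ‖χ.LFunction 1‖ + ‖χ.LFunction s - χ.LFunction 1 - deriv χ.LFunction 1 * (s - 1)‖ := by
    have := norm_add_le (χ.LFunction 1) (χ.LFunction s - χ.LFunction 1 - deriv χ.LFunction 1 * (s - 1))
    rw [show χ.LFunction 1 + (χ.LFunction s - χ.LFunction 1 - deriv χ.LFunction 1 * (s - 1)) =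
      χ.LFunction s - deriv χ.LFunction 1 * (s - 1) by ring] at this
    exact this
  -- sizes
  have hsq : ‖s - 1‖ ^ 2 ≤ (K * π / Lg ^ 9) ^ 2 := pow_le_pow_left₀ (norm_nonneg _) hs 2
  have hE := Real.exp_pos (9 / 2)
  have hrem' : ‖χ.LFunction s - χ.LFunction 1 - deriv χ.LFunction 1 * (s - 1)‖ ≤
      16 * Real.exp (9 / 2) * π ^ 2 * K ^ 2 / Lg ^ 15 := by
    refine hrem.trans ?_
    have h1L : 1 + Lg ≤ 2 * Lg := by linarith
    calc 8 * Real.exp (9 / 2) * (1 + Lg) * Lg ^ 2 * ‖s - 1‖ ^ 2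
        ≤ 8 * Real.exp (9 / 2) * (2 * Lg) * Lg ^ 2 * (K * π / Lg ^ 9) ^ 2 := by gcongr
      _ = 16 * Real.exp (9 / 2) * π ^ 2 * K ^ 2 / Lg ^ 15 := by field_simp; ring
  have hA' : ‖χ.LFunction 1‖ ≤ 1 / Lg ^ 15 := by
    refine hA.trans ?_
    exact div_le_div_of_nonneg_left (by norm_num) (by positivity)
      (pow_le_pow_right₀ hL1 (by norm_num))
  calc ‖χ.LFunction s - deriv χ.LFunction 1 * (s - 1)‖
      ≤ ‖χ.LFunction 1‖ + ‖χ.LFunction s - χ.LFunction 1 - deriv χ.LFunction 1 * (s - 1)‖ := hsplit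
    _ ≤ 1 / Lg ^ 15 + 16 * Real.exp (9 / 2) * π ^ 2 * K ^ 2 / Lg ^ 15 := add_le_add hA' hrem'
    _ = (1 + 16 * Real.exp (9 / 2) * π ^ 2 * K ^ 2) / Lg ^ 15 := by rw [hLdef]; ring

/-- **Zhang (2022), Lemma 5.8, kernel-checked** (the printed range `|s−1| ≤ 10α`, `α = π𝓛^{-9}`,
`α₂ = 𝓛^{-15}`): for every `D` with `log D ≥ 3`, every PRIMITIVE Dirichlet character `χ` mod `D`
satisfying (A) `‖L(1,χ)‖ ≤ (log D)^{-2022}`, and every `s` with `‖s − 1‖ ≤ 10π (log D)^{-9}`,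
`‖L(s,χ) − L′(1,χ)(s−1)‖ ≤ (1 + 1600e^{9/2}π²)·(log D)^{-15}`.
[cite: Zhang2022LandauSiegel, §5, Lemma 5.8] -/
theorem lemma_5_8 {D : ℕ} [NeZero D] (χ : DirichletCharacter ℂ D) (hprim : χ.IsPrimitive)
    (hL : 3 ≤ Real.log D) (hA : ‖χ.LFunction 1‖ ≤ 1 / Real.log D ^ 2022)
    {s : ℂ} (hs : ‖s - 1‖ ≤ 10 * π / Real.log D ^ 9) :
    ‖χ.LFunction s - deriv χ.LFunction 1 * (s - 1)‖ ≤
      (1 + 1600 * Real.exp (9 / 2) * π ^ 2) / Real.log D ^ 15 := by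
  have hπ4 : π ≤ 4 := by linarith [Real.pi_lt_four]
  have hKL : 10 * π ≤ Real.log D ^ 8 := by
    calc 10 * π ≤ 10 * 4 := by gcongr
      _ ≤ 3 ^ 8 := by norm_num
      _ ≤ Real.log D ^ 8 := pow_le_pow_left₀ (by norm_num) hL 8
  have h := lemma_5_8_of_le χ hprim hL hA (K := 10) hKL hs
  refine h.trans (le_of_eq ?_)
  ring

end Literature.NumberTheory.LFunctions.Zhang2022.Lemma58

end
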